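import Summits.SmoothPoincare4.SmoothPoincare4.Theorems.SymplecticOrigamiOrigamiFoldExistenceShadowPleatsTransport
import Summits.SmoothPoincare4.SmoothPoincare4.Theorems.SymplecticOrigamiOrigamiFoldExistenceShadowPleatsCleanDefs

/-!
# Zero-slack certificate of `stub_pleatNormalisation` (line `shadow-pleats`, crux `OrigamiFoldExistence`)
(item stmt-SmoothPoincare4-7844, route route-SmoothPoincare4-SymplecticOrigami; line lead seat c3, skeleton r4)

From r4 on the line `shadow-pleats` (skeleton `Cruxes/OrigamiFoldExistence/Lines/shadow_pleats.lean`) has ONE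
open stub, PLEAT NORMALISATION: every pleated round-rim position of a homotopy 4-sphere can be replaced by a
CLEAN position with at most two charts (`HasCleanPleatedPosition`, `…ShadowPleatsCleanDefs.lean`).  This file is
its ZERO-SLACK CERTIFICATE in kernel form, exactly as `stub_pleatCollapse_of_smoothPoincare4`
(`…ShadowPleatsTransport.lean`, p96867) was for the retired r1–r3 carrier `stub_pleatCollapse`:

* `hasCleanPleatedPosition_zero_of_nonempty_diffeomorph` — a 4-manifold diffeomorphic to the round `S⁴ ⊂ ℝ⁵`
  has a clean 0-chart position (transport of `hasPleatedPosition_sphere_zero` along the diffeomorphism,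
  `hasPleatedPosition_of_diffeomorph`; with no charts cleanness is vacuous, `hasCleanPleatedPosition_zero_iff`);
* `stub_pleatNormalisation_of_smoothPoincare4` — `SmoothPoincare4` implies the registered stub
  `stub_pleatNormalisation` VERBATIM (with `k' = 0`).

Conversely (paper, recorded in the skeleton): given S2 (pleated positions exist, E–M) and the recognition theorem
"all-clean ⇒ `M ≅ S⁴`" (S4 worker's Theorem C; rungs S6 landed, S5a/S4a true), `stub_pleatNormalisation` implies
`SmoothPoincare4`; so the stub is exactly SPC4-hard — the named zero-slack carrier.

Deliberately NOT here: any claim towards `stub_pleatNormalisation` itself (open problem).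
-/

noncomputable section

-- the prescribed namespace `Summit.<P>.<Sub>.…` duplicates `SmoothPoincare4` (P = Sub)
set_option linter.dupNamespace false

open scoped Manifold ContDiff Topology
open Set Function ContinuousMap

namespace Summit.SmoothPoincare4.SmoothPoincare4.Theorems.OrigamiFoldExistence.ShadowPleats

/-- **A 4-manifold diffeomorphic to the round sphere has a CLEAN pleat-free position**: transport the round
sphere's own 0-chart position (`hasPleatedPosition_sphere_zero`) along the diffeomorphism
(`hasPleatedPosition_of_diffeomorph`); with no charts, cleanness is vacuous
(`hasCleanPleatedPosition_zero_iff`). [folklore] -/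
theorem hasCleanPleatedPosition_zero_of_nonempty_diffeomorph {M : Type} [TopologicalSpace M] [T2Space M]
    [SecondCountableTopology M] [ChartedSpace (EuclideanSpace ℝ (Fin 4)) M] [IsManifold (𝓡 4) ∞ M]
    (h : Nonempty (M ≃ₘ⟮𝓡 4, 𝓡 4⟯ (Metric.sphere (0 : EuclideanSpace ℝ (Fin 5)) 1))) :
    HasCleanPleatedPosition M 0 := by
  obtain ⟨Φ⟩ := h
  exact (hasCleanPleatedPosition_zero_iff M).2
    (hasPleatedPosition_of_diffeomorph M _ Φ 0 hasPleatedPosition_sphere_zero)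

/-- **Zero-slack certificate of `stub_pleatNormalisation` (kernel form).** The smooth 4-dimensional Poincaré
conjecture `SmoothPoincare4` implies the registered stub `stub_pleatNormalisation` of line `shadow-pleats`
(skeleton r4) verbatim, with `k' = 0` and ignoring the given `k`-chart position: a homotopy 4-sphere is then
diffeomorphic to the round `S⁴ ⊂ ℝ⁵`, which is in clean pleat-free position, and positions transport along
diffeomorphisms.  Together with the converse through S2 and the recognition rungs this exhibits
`stub_pleatNormalisation` as the line's zero-slack carrier. [folklore] -/
theorem stub_pleatNormalisation_of_smoothPoincare4 (hS : _root_.SmoothPoincare4) :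
    ∀ (M : Type) [TopologicalSpace M] [T2Space M] [SecondCountableTopology M]
      [ChartedSpace (EuclideanSpace ℝ (Fin 4)) M] [IsManifold (𝓡 4) ∞ M],
      M ≃ₕ (Metric.sphere (0 : EuclideanSpace ℝ (Fin 5)) 1) →
      ∀ k, HasPleatedPosition M k → ∃ k', k' ≤ 2 ∧ HasCleanPleatedPosition M k' := by
  intro M _ _ _ _ _ hM k _
  have hS' := hS
  unfold _root_.SmoothPoincare4 Literature.SPC4.SmoothPoincareConjectureFour
    ContinuousMap.HomotopyEquiv.NonemptyDiffeomorphSphere at hS'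
  exact ⟨0, Nat.zero_le 2,
    hasCleanPleatedPosition_zero_of_nonempty_diffeomorph (hS' M inferInstance inferInstance hM)⟩

end Summit.SmoothPoincare4.SmoothPoincare4.Theorems.OrigamiFoldExistence.ShadowPleats

end
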